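import Mathlib
import Literature.Barriers.ValiantsHypothesis.FullRankMultilinearHolds
import Literature.Barriers.ValiantsHypothesis.AlgebraicNaturalProofs
import Literature.Computability.AlgebraicComplexity.ArithCircuitProofs

/-!
# Route BarrierLever — crux `DefinableEquations` (stmt-8745) / item `SingleSizeEquations`
# (stmt-8749): a METHOD WALL — the FULL-RANK (min-partition-rank) METHOD IS SATURATED BY A
# POLYNOMIAL OF CUBIC COMPLEXITY OVER `ℂ` (Raz–Yehudayoff specialised; val-np-p5 g10)

g9 made Raz's full-rank method an FSV-natural proof in the crux's regime
(`…FullRankMethod.lean`: a level-5 distinguisher `E_n` vanishing at `coeff(g)` for every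
`g ∈ ℂ[x_1..x_{2n}]` that is NOT of full rank) and landed its reach: syntactically multilinear
circuits of size `< c·n²/log² n` (Alon–Kumar–Volk) and multilinear formulas of every polynomial
size (Raz).  This file records the WALL of that method against GENERAL circuits, in the crux's own
vocabulary and over `ℂ`:

**Theorem (`exists_isFullRank_smallCircuits`).**  For every `n ≥ 2` there is a polynomial
`g ∈ ℂ[x_1, …, x_{2n}]` of degree `≤ 2n` and fan-in-two complexity `≤ 6(n³+1) ≤ (2n)³` — so
`g ∈ SmallCircuits ℂ (2n) 3` — which IS of full rank (`IsFullRank n g`: for EVERY balanced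
partition the `2^n × 2^n` partial-derivative matrix is nonsingular).  It is the Raz–Yehudayoff
polynomial `f_{1,2n}` with its auxiliary variables `ω_{i,ℓ,j}` SPECIALISED to complex numbers.

The tree already holds the barrier over the function field `K = ℂ(W)` (`FullRankMultilinear_holds`
= [RazYehudayoff2008, Thm. 4.2] proved + the `O(n³)` circuit `RazYehudayoff.ryCircuit`, phrased for
the syntactically multilinear measure `smCircuitSize`).  What is added here is the passage to `ℂ`
and to the crux's classes: (§1) over `ℂ[W]` every one of the `binom(2n,n)` cut determinants of the
generic polynomial is a nonzero polynomial in `W` (`det_cM_generic_ne_zero`, from Thm. 4.2 over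
`ℂ(W)` by clearing the fraction field); (§2) their product is nonzero, so ONE point `ω ∈ ℂ^{W}`
makes all of them nonzero at once (`exists_good_specialisation`, `MvPolynomial.funext`), i.e.
`f_ω` is of full rank over `ℂ` (`isFullRank_specialise`); (§3) `f_ω` is computed by the tree's
circuit `ryCircuit ℂ n c` with constants `c = ω`, so `complexity f_ω ≤ 6(n³+1)`
(`complexity_specialise_le`), and `deg f_ω ≤ 2n` (`totalDegree_ryFc_le`, even lengths);
(§4) the wall: `{g : ¬ IsFullRank n g}` does not contain `SmallCircuits ℂ (2n) b` for any `b ≥ 3`,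
`n ≥ 2` (`not_smallCircuits_subset_notFullRank`); no polynomial `D` in the coefficient variables
that is nonzero at every full-rank polynomial vanishes on `SmallCircuits ℂ (2n) b`
(`no_fullRankCertificate_smallCircuits`) — in particular a `D` whose zero set on degree-`≤ 2n`
coefficient vectors is exactly the non-full-rank locus (as g9's `E_n`) is not an
`IsNaturalProof` against `SmallCircuits ℂ (2n) b`, `b ≥ 3`, in ANY distinguisher class
(`not_isNaturalProof_of_zeroSet_notFullRank`).

Chart line: full-rank method — natural proofs up to synt.-multilinear size `n²/log² n` and all
multilinear formulas (g9); WALL at general (indeed syntactically multilinear) size `8n³` (this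
file; Raz–Yehudayoff's separation).  What this is NOT: nothing on other methods, on the crux
(b = 2 OPEN, Chatterjee–Tengse §1.3 dir. 2) or on `VP ≠ VNP`.  No definitions, no named facts,
standard axioms.  Refs: Raz–Yehudayoff, Comput. Complexity 17 (2008) §4.1, Thm. 4.2, Thm. 4.4;
Alon–Kumar–Volk, Combinatorica 40 (2020) §4.1; Forbes–Shpilka–Volk 2018 Def. 1/3.
-/

-- `Summit.ValiantsHypothesis.ValiantsHypothesis.…` repeats a component by the D-0017 layout
-- (single-conjunct summit), which the `dupNamespace` linter flags; the name is mandated.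
set_option linter.dupNamespace false

noncomputable section

namespace Summit.ValiantsHypothesis.ValiantsHypothesis.Theorems.BarrierLeverDefinableEquations

open MvPolynomial
open Literature.Computability.AlgebraicComplexity hiding IsSyntacticallyMultilinear smCircuitSize
open Literature.Barriers.ValiantsHypothesis
open Literature.Barriers.ValiantsHypothesis.RazYehudayoff
open scoped BigOperators

namespace FullRankMethodWall

universe u

/-! ## §0 Square matrices over a field: rank `= #rows` is invertibility -/

section Rank

variable {K : Type*} [Field K] {ι : Type*} [Fintype ι] [DecidableEq ι]

/-- A square matrix of full rank is invertible. [folklore] -/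
theorem isUnit_of_rank_eq_card (A : Matrix ι ι K) (h : A.rank = Fintype.card ι) : IsUnit A := by
  rw [← Matrix.mulVec_surjective_iff_isUnit]
  have htop : LinearMap.range A.mulVecLin = ⊤ := by
    apply Submodule.eq_top_of_finrank_eq
    rw [Module.finrank_fintype_fun_eq_card]
    exact h
  intro v
  have hv : v ∈ LinearMap.range A.mulVecLin := htop ▸ Submodule.mem_top
  obtain ⟨w, hw⟩ := hv
  exact ⟨w, hw⟩

/-- An invertible square matrix has full rank. [folklore] -/
theorem rank_eq_card_of_det_ne_zero (A : Matrix ι ι K) (h : A.det ≠ 0) :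
    A.rank = Fintype.card ι :=
  Matrix.rank_of_isUnit _ ((Matrix.isUnit_iff_isUnit_det _).2 (isUnit_iff_ne_zero.2 h))

end Rank

/-! ## §1 The generic Raz–Yehudayoff polynomial over `ℂ[W]`: every cut determinant is a nonzero
polynomial in the auxiliary variables -/

section Generic

variable (n : ℕ)

/-- **Thm. 4.2 cleared of denominators**: for every balanced partition `A`, the determinant of
the partial-derivative matrix of the generic Raz–Yehudayoff polynomial (coefficients `ω_{i,ℓ,j}`
the variables of `ℂ[W]`) is a NONZERO element of `ℂ[W]`. [cite: RazYehudayoff2008, Thm. 4.2] -/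
theorem det_cM_generic_ne_zero (A : Fin (2 * n) ≃ Fin n ⊕ Fin n) :
    (cM (rename A (ryFc (MvPolynomial (RYAux (2 * n)) ℂ) (2 * n) (wPoly ℂ (2 * n))
      (n + 1) (2 * n) 0))).det ≠ 0 := by
  classical
  intro h0
  have hrank := RazYehudayoff2008_thm42_holds ℂ n A
  have hU : IsUnit (pdMatrix (rename A (razYehudayoffPolyK ℂ n))) :=
    isUnit_of_rank_eq_card _ (by rw [hrank, Fintype.card_finset, Fintype.card_fin])
  have hdet : (pdMatrix (rename A (razYehudayoffPolyK ℂ n))).det ≠ 0 :=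
    isUnit_iff_ne_zero.1 ((Matrix.isUnit_iff_isUnit_det _).1 hU)
  apply hdet
  rw [razYehudayoffPolyK_eq, pdMatrix_eq_cM, det_cM_map_rename, h0, map_zero]

/-- The product of all `binom(2n,n)` cut determinants is a nonzero polynomial in `W`.
[cite: RazYehudayoff2008, Thm. 4.2] -/
theorem prod_det_cM_generic_ne_zero :
    (∏ A : Fin (2 * n) ≃ Fin n ⊕ Fin n,
      (cM (rename A (ryFc (MvPolynomial (RYAux (2 * n)) ℂ) (2 * n) (wPoly ℂ (2 * n))
        (n + 1) (2 * n) 0))).det) ≠ 0 :=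
  Finset.prod_ne_zero_iff.2 fun A _ => det_cM_generic_ne_zero n A

end Generic

/-! ## §2 One complex specialisation good for all partitions -/

section Specialise

variable (n : ℕ)

/-- There is a point `ω ∈ ℂ^W` at which all cut determinants are nonzero. [folklore] -/
theorem exists_good_specialisation :
    ∃ ω : RYAux (2 * n) → ℂ, ∀ A : Fin (2 * n) ≃ Fin n ⊕ Fin n,
      eval ω (cM (rename A (ryFc (MvPolynomial (RYAux (2 * n)) ℂ) (2 * n) (wPoly ℂ (2 * n))
        (n + 1) (2 * n) 0))).det ≠ 0 := by
  classical
  set Q := ∏ A : Fin (2 * n) ≃ Fin n ⊕ Fin n,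
      (cM (rename A (ryFc (MvPolynomial (RYAux (2 * n)) ℂ) (2 * n) (wPoly ℂ (2 * n))
        (n + 1) (2 * n) 0))).det with hQ
  have hQ0 : Q ≠ 0 := prod_det_cM_generic_ne_zero n
  obtain ⟨ω, hω⟩ : ∃ ω : RYAux (2 * n) → ℂ, eval ω Q ≠ 0 := by
    by_contra h
    simp only [not_exists, not_not] at h
    exact hQ0 (MvPolynomial.funext fun ω => by rw [h ω, map_zero])
  refine ⟨ω, fun A => ?_⟩
  rw [hQ, map_prod] at hω
  exact Finset.prod_ne_zero_iff.1 hω A (Finset.mem_univ A)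

/-- **The specialised Raz–Yehudayoff polynomial is of full rank over `ℂ`**: with
`c_{i,ℓ,j} = ω_{i,ℓ,j} ∈ ℂ` a good specialisation, `f^{c}_{[0,2n)}` has all `binom(2n,n)`
partial-derivative matrices nonsingular. [cite: RazYehudayoff2008, Thm. 4.2] -/
theorem isFullRank_specialise :
    ∃ ω : RYAux (2 * n) → ℂ,
      IsFullRank n (ryFc ℂ (2 * n) (fun i l j => eval ω (wPoly ℂ (2 * n) i l j)) (n + 1) (2 * n) 0) := by
  classical
  obtain ⟨ω, hω⟩ := exists_good_specialisation n
  refine ⟨ω, fun A => ?_⟩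
  have hmap : ryFc ℂ (2 * n) (fun i l j => eval ω (wPoly ℂ (2 * n) i l j)) (n + 1) (2 * n) 0 =
      MvPolynomial.map (eval ω) (ryFc (MvPolynomial (RYAux (2 * n)) ℂ) (2 * n) (wPoly ℂ (2 * n))
        (n + 1) (2 * n) 0) := by
    rw [map_ryFc]
  have hdet : (pdMatrix (rename A (ryFc ℂ (2 * n) (fun i l j => eval ω (wPoly ℂ (2 * n) i l j))
      (n + 1) (2 * n) 0))).det ≠ 0 := by
    rw [pdMatrix_eq_cM, hmap, det_cM_map_rename]
    exact hω A
  rw [rank_eq_card_of_det_ne_zero _ hdet, Fintype.card_finset, Fintype.card_fin]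

end Specialise

/-! ## §3 Degree and complexity of the specialised polynomial -/

section Size

variable {S : Type*} [CommSemiring S] {N : ℕ}

/-- `deg x_k ≤ 1`. [folklore] -/
theorem totalDegree_xv_le (k : ℕ) : (xv S N k).totalDegree ≤ 1 := by
  unfold xv
  split_ifs
  · rcases subsingleton_or_nontrivial S with hS | hS
    · simp [Subsingleton.elim (X _ : MvPolynomial (Fin N) S) 0]
    · rw [totalDegree_X]
  · simp

/-- **`deg f_{[i, i+len)} ≤ len` for even `len`** (the polynomials are multilinear in the
`len` variables of their interval; even lengths only — `f` of an interval of length `1` would be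
`1 + x_i²`). [cite: RazYehudayoff2008, §4.1] -/
theorem totalDegree_ryFc_le (c : ℕ → ℕ → ℕ → S) (fuel : ℕ) :
    ∀ len i : ℕ, Even len → (ryFc S N c fuel len i).totalDegree ≤ len := by
  induction fuel with
  | zero => intro len i _; simp [ryFc]
  | succ fuel ih =>
    intro len i hlen
    by_cases h0 : len = 0
    · subst h0; simp
    · have h2 : 2 ≤ len := by obtain ⟨r, rfl⟩ := hlen; omega
      rw [ryFc_succ c h0]
      refine (totalDegree_add _ _).trans (max_le ?_ ?_)
      · refine (totalDegree_mul _ _).trans ?_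
        have hA : (1 + xv S N i * xv S N (i + len - 1)).totalDegree ≤ 2 := by
          refine (totalDegree_add _ _).trans (max_le (by simp) ?_)
          refine (totalDegree_mul _ _).trans ?_
          have := totalDegree_xv_le (S := S) (N := N) i
          have := totalDegree_xv_le (S := S) (N := N) (i + len - 1)
          omega
        have hB := ih (len - 2) (i + 1) (by obtain ⟨r, rfl⟩ := hlen; exact ⟨r - 1, by omega⟩)
        omega
      · refine (totalDegree_finsetSum _ _).trans (Finset.sup_le fun a ha => ?_)
        simp only [Finset.mem_filter, Finset.mem_range] at ha
        obtain ⟨ha1, ha2, ha3⟩ := ha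
        refine (totalDegree_mul _ _).trans ?_
        refine (Nat.add_le_add (totalDegree_mul _ _) le_rfl).trans ?_
        have h1 : (C (c i (i + a - 1) (i + len - 1)) : MvPolynomial (Fin N) S).totalDegree = 0 :=
          totalDegree_C _
        have h2' := ih a i ha2
        have h3 := ih (len - a) (i + a) (by
          obtain ⟨r, rfl⟩ := hlen; obtain ⟨s, rfl⟩ := ha2; exact ⟨r - s, by omega⟩)
        omega

/-- Out of range the specialised coefficients vanish (so the tree's circuit applies). [folklore] -/
theorem eval_wPoly_eq_zero {n : ℕ} (ω : RYAux (2 * n) → ℂ) {i : ℕ} (hi : 2 * n ≤ i) (l j : ℕ) :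
    eval ω (wPoly ℂ (2 * n) i l j) = 0 := by
  unfold wPoly
  rw [dif_neg (by omega), map_zero]

/-- **Complexity of the specialised polynomial**: `L(f_ω) ≤ 6(n³ + 1)` — it is the output of the
tree's fan-in-two circuit `ryCircuit ℂ n c` (the tabulated recursion, `4n³ + 2n²` gates) with
constants `c = ω`. [cite: RazYehudayoff2008, §4.1 and Thm. 4.4(2)] [cite: AlonKumarVolk2020, §4.1] -/
theorem complexity_specialise_le {n : ℕ} (ω : RYAux (2 * n) → ℂ) :
    complexity (ryFc ℂ (2 * n) (fun i l j => eval ω (wPoly ℂ (2 * n) i l j)) (n + 1) (2 * n) 0) ≤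
      6 * (n ^ 3 + 1) := by
  set c : ℕ → ℕ → ℕ → ℂ := fun i l j => eval ω (wPoly ℂ (2 * n) i l j) with hc
  have hc0 : ∀ i l j, 2 * n ≤ i → c i l j = 0 := fun i l j hi => eval_wPoly_eq_zero ω hi l j
  have hfuel : ryFc ℂ (2 * n) c (n + 1) (2 * n) 0 = gv ℂ n c (2 * n) 0 :=
    ryFc_stable c (by omega) (by omega) 0
  rw [hfuel]
  exact (ArithCircuit.complexity_le_size (isFanInTwo_ryCircuit ℂ n c) (eval_ryCircuit ℂ hc0)).trans
    (size_ryCircuit_le ℂ n c)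

end Size

/-! ## §4 The wall -/

section Wall

/-- **A full-rank polynomial of cubic complexity over `ℂ`**: for every `n` some
`g ∈ ℂ[x_1, …, x_{2n}]` with `deg g ≤ 2n` and `L(g) ≤ 6(n³+1)` is of full rank.
[cite: RazYehudayoff2008, Thm. 4.2 and Thm. 4.4(2)] -/
theorem exists_isFullRank_complexity_le (n : ℕ) :
    ∃ g : MvPolynomial (Fin (2 * n)) ℂ, g.totalDegree ≤ 2 * n ∧ complexity g ≤ 6 * (n ^ 3 + 1) ∧
      IsFullRank n g := by
  obtain ⟨ω, hω⟩ := isFullRank_specialise n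
  exact ⟨_, totalDegree_ryFc_le _ (n + 1) (2 * n) 0 (even_two_mul n), complexity_specialise_le ω, hω⟩

/-- Hence a member of `SmallCircuits ℂ (2n) b` of full rank, for every `b ≥ 3` and `n ≥ 2`
(`6(n³+1) ≤ 8n³ = (2n)³`). [cite: ForbesShpilkaVolk2018, Cor. 5] -/
theorem exists_isFullRank_smallCircuits {n b : ℕ} (hn : 2 ≤ n) (hb : 3 ≤ b) :
    ∃ g ∈ SmallCircuits ℂ (2 * n) b, IsFullRank n g := by
  obtain ⟨g, hdeg, hL, hfull⟩ := exists_isFullRank_complexity_le n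
  refine ⟨g, ⟨hdeg, hL.trans ?_⟩, hfull⟩
  have h3 : 6 * (n ^ 3 + 1) ≤ (2 * n) ^ 3 := by
    have : 2 * 2 * 2 ≤ n * n * n := by
      have h1 : 2 * 2 ≤ n * n := Nat.mul_le_mul hn hn
      exact Nat.mul_le_mul h1 hn
    nlinarith
  exact h3.trans (Nat.pow_le_pow_right (by omega) hb)

/-- **The wall, set form**: the non-full-rank locus — the zero set of g9's full-rank equation
`E_n` — does NOT contain `SmallCircuits ℂ (2n) b` for any `b ≥ 3`, `n ≥ 2`.
[cite: RazYehudayoff2008, Thm. 4.4] -/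
theorem not_smallCircuits_subset_notFullRank {n b : ℕ} (hn : 2 ≤ n) (hb : 3 ≤ b) :
    ¬ SmallCircuits ℂ (2 * n) b ⊆ {g : MvPolynomial (Fin (2 * n)) ℂ | ¬ IsFullRank n g} := by
  intro h
  obtain ⟨g, hg, hfull⟩ := exists_isFullRank_smallCircuits hn hb
  exact h hg hfull

/-- **The wall, certificate form**: no polynomial `D` in the `N = binom(4n,2n)` coefficient
variables (any size, any degree, Boolean sums included) that is NONZERO at every full-rank
polynomial of degree `≤ 2n` — the soundness property of a full-rank-method certificate — vanishes
on `SmallCircuits ℂ (2n) b`, `b ≥ 3`, `n ≥ 2`. [cite: ForbesShpilkaVolk2018, Def. 1] -/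
theorem no_fullRankCertificate_smallCircuits {n b : ℕ} (hn : 2 ≤ n) (hb : 3 ≤ b) :
    ¬ ∃ D : MvPolynomial (degLEMonomials (2 * n)) ℂ,
      (∀ g : MvPolynomial (Fin (2 * n)) ℂ, g.totalDegree ≤ 2 * n → IsFullRank n g →
        eval (coeffVector (degLEMonomials (2 * n)) g) D ≠ 0) ∧
      ∀ f ∈ SmallCircuits ℂ (2 * n) b, eval (coeffVector (degLEMonomials (2 * n)) f) D = 0 := by
  rintro ⟨D, hsound, hvan⟩
  obtain ⟨g, hg, hfull⟩ := exists_isFullRank_smallCircuits hn hb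
  exact hsound g hg.1 hfull (hvan g hg)

/-- In FSV's vocabulary: a `D` whose zero set on degree-`≤ 2n` coefficient vectors is exactly the
non-full-rank locus (as g9's `E_n`) is not an `IsNaturalProof` against `SmallCircuits ℂ (2n) b`,
`b ≥ 3`, `n ≥ 2`, in ANY distinguisher class `𝒟`. [cite: ForbesShpilkaVolk2018, Def. 1] -/
theorem not_isNaturalProof_of_zeroSet_notFullRank {n b : ℕ} (hn : 2 ≤ n) (hb : 3 ≤ b)
    (𝒟 : Set (MvPolynomial (degLEMonomials (2 * n)) ℂ)) (D : MvPolynomial (degLEMonomials (2 * n)) ℂ)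
    (hD : ∀ g : MvPolynomial (Fin (2 * n)) ℂ, g.totalDegree ≤ 2 * n →
      (eval (coeffVector (degLEMonomials (2 * n)) g) D = 0 ↔ ¬ IsFullRank n g)) :
    ¬ IsNaturalProof (degLEMonomials (2 * n)) (SmallCircuits ℂ (2 * n) b) 𝒟 D := by
  rintro ⟨-, -, hvan⟩
  obtain ⟨g, hg, hfull⟩ := exists_isFullRank_smallCircuits hn hb
  exact (hD g hg.1).1 (hvan g hg) hfull

/-- The same against the syntactically multilinear measure, over `ℂ` (the tree's
`not_fullRankMethodProves_cubic` is over `K = F(W)`): `FullRankMethodProves ℂ n s` fails for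
`s = 6(n³+1)`. [cite: AlonKumarVolk2020, §4.1 (closing remark)] -/
theorem not_fullRankMethodProves_complex (n : ℕ) : ¬ FullRankMethodProves ℂ n (6 * (n ^ 3 + 1)) := by
  intro h
  obtain ⟨ω, hω⟩ := isFullRank_specialise n
  set c : ℕ → ℕ → ℕ → ℂ := fun i l j => eval ω (wPoly ℂ (2 * n) i l j) with hc
  have hc0 : ∀ i l j, 2 * n ≤ i → c i l j = 0 := fun i l j hi => eval_wPoly_eq_zero ω hi l j
  have hlt := h _ hω
  have hfuel : ryFc ℂ (2 * n) c (n + 1) (2 * n) 0 = gv ℂ n c (2 * n) 0 :=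
    ryFc_stable c (by omega) (by omega) 0
  rw [hfuel] at hlt
  have hle := (Literature.Barriers.ValiantsHypothesis.smCircuitSize_le (isFanInTwo_ryCircuit ℂ n c)
    (isSyntacticallyMultilinear_ryCircuit ℂ n c) (eval_ryCircuit ℂ hc0)).trans
    (show ((ryCircuit ℂ n c).size : ℕ∞) ≤ ((6 * (n ^ 3 + 1) : ℕ) : ℕ∞) by
      exact_mod_cast size_ryCircuit_le ℂ n c)
  exact absurd (lt_of_lt_of_le hlt hle) (lt_irrefl _)

end Wall

end FullRankMethodWall

end Summit.ValiantsHypothesis.ValiantsHypothesis.Theorems.BarrierLeverDefinableEquations
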